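import Mathlib.NumberTheory.LSeries.RiemannZeta
import Mathlib.NumberTheory.SmoothNumbers
import Mathlib.Analysis.SpecialFunctions.Pow.Real
import Literature.NumberTheory.Sieve.DickmanFunction
import HarnessLib

/-!
# RH-EQUIVALENT · Hildebrand (1984): RH iff `Ψ(x,y) = xρ(u) exp{O_ε(log(u+1)/log y)}` uniformly for `y ≥ 2`, `1 ≤ u ≤ y^{1/2−ε}` — typed statement only; nothing here bears on the truth of RH

Literature-typing tranche `rh-lit-broughan-2` (Broughan, *Equivalents of the Riemann Hypothesis*,
Vol. 2, Ch. 13 "Smooth Numbers", chapter doi 10.1017/9781108178266.015 — the volume is NOT held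
(acq-04815); the primary source [Hildebrand1984RH] (Mathematika 31) is not held; the statement is typed
from the restatement in the survey [HildebrandTenenbaum1993] §1, read).

`Ψ(x, y)` = number of integers `1 ≤ n ≤ x` all of whose prime factors are `≤ y`; `u = log x / log y`;
`ρ` = Dickman's function (tree: `Literature.NumberTheory.Sieve.dickmanRho`). Unconditionally the
asymptotic `Ψ(x,y) = xρ(u) exp{O(log(u+1)/log y)}` holds for `1 ≤ u ≤ exp{(log y)^{3/5−ε}}`
(Hildebrand 1986, HT93 Thm 1.1); its extension to the full range `u ≤ y^{1/2−ε}` is equivalent to RH.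

## Contents

* `smoothCountReal x y` — `Ψ(x, y)` for real `x, y ≥ 0`, in the tree's convention
  `#(Nat.smoothNumbersUpTo ⌊x⌋₊ (⌊y⌋₊ + 1))` (Mathlib's `smoothNumbersUpTo N k` counts `1 ≤ n ≤ N`
  with all prime factors `< k`).
* `Hildebrand1984_criterion` — NAMED FACT (RH-EQUIVALENT, range-indexed): RH iff for every
  `ε > 0` there is `C` with `|log(Ψ(x,y)/(xρ(u)))| ≤ C log(u+1)/log y` whenever `y ≥ 2` and
  `1 ≤ u ≤ y^{1/2−ε}`.

## Sources read

* [HildebrandTenenbaum1993] A. Hildebrand, G. Tenenbaum, *Integers without large prime factors*,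
  J. Théor. Nombres Bordeaux 5 (1993) 411–484 (held: `paper:doi-10-5802-jtnb-101`), §1 after
  Thm 1.1 (p. 416): "one can show that (1.8) in the form `Ψ(x, y) = xρ(u) exp{O(log(u+1)/log y)}`
  holds uniformly in the range `y ≥ 2`, `1 ≤ u ≤ y^{1/2−ε}`, for any fixed `ε > 0`, if and only if
  the Riemann Hypothesis is true; see Hildebrand (1984a)."
* [Hildebrand1984RH] A. Hildebrand, *Integers free of large prime factors and the Riemann
  hypothesis*, Mathematika 31 (1984) 258–271 (primary; not held).
* [Broughan2017] Vol. 2 Ch. 13 (secondary locator; not held).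

## Design notes

* "uniformly … for any fixed `ε`" = `∀ ε > 0, ∃ C, ∀ x y` in the range; `exp{O(·)}` is written as a
  two-sided bound on `log(Ψ/(xρ(u)))` (both `Ψ ≥ 1` and `xρ(u) > 0` in the range, so no junk `log`).
* `u ≥ 1` is `y ≤ x`; `u ≤ y^{1/2−ε}` uses `Real.rpow`.
* SHAPE for the splitting matrix: RANGE-INDEXED (`∀ ε`, `∃ C`, then `∀ (x,y)` in a two-parameter
  range; each instance `Ψ(x,y)` is computable but the `O`-constant is not printed) — treat as ASYMPTOTIC
  (no certified finite part without an explicit `C`); family NEW (smooth numbers) ~ zd (the proof goes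
  through zero-free regions: RH ⟺ `ζ` zero-free on `Re s > 1/2`, intermediate ranges ⟺ quasi-RH,
  Hildebrand 1984a).
-/

noncomputable section

open Real Finset

namespace Literature.NumberTheory.LFunctions

/-- `Ψ(x, y)`: the number of integers `1 ≤ n ≤ x` all of whose prime factors are `≤ y` (real
`x, y ≥ 0`), as `#(Nat.smoothNumbersUpTo ⌊x⌋₊ (⌊y⌋₊ + 1))` (a prime `p` satisfies `p ≤ y ↔ p < ⌊y⌋₊ + 1`).
[cite: HildebrandTenenbaum1993, §1 (definition of Ψ(x,y))] -/
def smoothCountReal (x y : ℝ) : ℕ :=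
  (Nat.smoothNumbersUpTo ⌊x⌋₊ (⌊y⌋₊ + 1)).card

/-- NAMED FACT **Hildebrand's criterion** (A. Hildebrand, Mathematika 31 (1984) 258–271; as printed in
Hildebrand–Tenenbaum, JTNB 5 (1993), §1 p. 416: "`Ψ(x, y) = xρ(u) exp{O(log(u+1)/log y)}` holds
uniformly in the range `y ≥ 2`, `1 ≤ u ≤ y^{1/2−ε}`, for any fixed `ε > 0`, if and only if the
Riemann Hypothesis is true"). With `u = log x/log y` and `ρ` Dickman's function: RH holds iff for every
`ε > 0` there is a constant `C` such that `|log(Ψ(x,y)/(xρ(u)))| ≤ C log(u+1)/log y` for all real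
`x, y` with `2 ≤ y ≤ x` and `u ≤ y^{1/2−ε}`. Users take `(h : Hildebrand1984_criterion)`. Secondary:
Broughan 2017 Vol. 2 Ch. 13 (not held). [cite: Hildebrand1984RH, main theorem (as printed in HildebrandTenenbaum1993 §1)] -/
def Hildebrand1984_criterion : Prop :=
  RiemannHypothesis ↔
    ∀ ε : ℝ, 0 < ε → ∃ C : ℝ, ∀ x y : ℝ, 2 ≤ y → y ≤ x →
      Real.log x / Real.log y ≤ y ^ (1 / 2 - ε) →
        |Real.log ((smoothCountReal x y : ℝ) /
            (x * Literature.NumberTheory.Sieve.dickmanRho (Real.log x / Real.log y)))| ≤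
          C * Real.log (Real.log x / Real.log y + 1) / Real.log y

end Literature.NumberTheory.LFunctions

end
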